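import Summits.QuantumFields.YangMills.Theorems.UnitScaleTiltProp7Lane2CutoffFamilyLaplacian
import Literature.MathematicalPhysics.QuantumFieldTheory.Balaban1983to89.B9B8KnitLetterCoercive
import HarnessLib

/-!
# Route `UnitScaleTilt`, crux «MinimiserStabilityRegPr» (stmt-QuantumFields-19200), E′ ∕ (N06) LANE II «DIVERGENCE RECOVERY AT CURVED `W`» — brick (B6), row `h11`: THE H¹ (DIV ⊕ CURL) ENERGY
# OF THE GRADIENT COMMUTATOR `u = D_W(ζλ) − ζ(·₋)D_Wλ = η(∂ζ)•Ad(W)λ(·₊)`.  DIV: `divB_W u = −ηΣ_μ[(∂²_μζ)•λ + (∂_μζ)•D_μλ]` EXACTLY (no curvature), so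
# `Σ_x hs(divB_W u) ≤ 6η²(3a₂²·Σ_S hs(λ) + a²·Σ_SΣ_μ hs(D_μλ))`.  CURL: `curl_W u (x,μ,ν) = η∂_νζ•Ad(W_ν)D_μλ(x+e_ν) − η∂_μζ•Ad(W_μ)D_νλ(x+e_μ) + η(…)•(Ad(W_μW_ν′) − Ad(W_νW_μ′))λ(x+e_μ+e_ν)`
# EXACTLY — the mixed difference of `ζ` multiplies ONLY the curvature commutator (plaquette deviation `ε`), so `Σ hs(curl_W u) ≤ 18η²a²·ΣΣ_μ hs(D_μλ) + 1728η²a²ε²·Σ hs(λ)`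

Cell `ym3-torus`, width seat `ym3-torus-px11` (gen 6); ★p1 g19 LANE II NAMER WORD №9 «T := Qkc; (QH1) enters; px11 g6: `CURL∕DIV([D,Z_i]φ_i) ≤ C(R⁻²‖D_Wφ_i‖² + R⁻⁴‖φ_i‖²)` — one more
commutator row in your (B6) PACKAGE, same letters».  THEOREMS ONLY (0 `def`, 0 `sorry`); `--supports stmt-QuantumFields-19200`, count-neutral.  YM₃ on T³ is a ladder rung (R3), not the
Clay problem; nothing here claims (B7), (REC), `hN06`, a stub, the crux, d = 4 or the mass gap.

THE OBJECT.  `u(κ, z) := η⁻¹(ζ(z+e_κ) − ζ(z))•Ad(U_κ(z))λ(z+e_κ)` is the gradient commutator `D_W(ζλ) − ζ(·₋)D_Wλ` of ✓ `…Lane2CutoffCommutators.DL2_smul_sub_smul_apply` read as a lattice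
one-form (`U_κ(z) = W♭⟨z,κ⟩`).  Its covariant divergence needs NO curvature: `Ad(U⁻¹)Ad(U) = 1` kills the transport, leaving second differences of `ζ` times `λ` and first differences of
`ζ` times covariant differences of `λ` — so the DIV half of the H¹ row follows from the step∕second-difference rows already displayed by ✓p705373 (§1–§2); the CURL half (§3–§5) needs only the steps of `ζ` and the plaquette deviation of `U`.
* §1 ★ `divB_gradComm_apply` — the exact divergence formula (any units-valued `U`); §2 ★★ `hs_divB_gradComm_point_le` ∕ `hs_divB_gradComm_sum_le` — per cutoff, localised to any
  finset `S` containing the sites where `ζ` is not locally constant (steps `≤ a`, second differences `≤ a₂`: rows 6–7 of ✓p705373).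
* §3 ★ `curl_gradComm_eq` — the exact curl identity; §4 ★★ `hs_curl_gradComm_point_le` — `hs(curl u (x,μ,ν)) ≤ 3η²a²[hs(D_μλ(x+e_ν)) + hs(D_νλ(x+e_μ))] + 192η²a²ε² hs(λ(x+e_μ+e_ν))`
  under `U ∈ U1` unitary, steps `|∂ζ| ≤ a`, plaquette deviation `‖U_μ(x)U_ν(x+e_μ) − U_ν(x)U_μ(x+e_ν)‖ ≤ ε` (lit ✓`B9B8KnitLetterCoercive.hs_R_sub_R_le`); §5 ★★ `hs_curl_gradComm_sum_le` —
  summed over sites and direction pairs (`6d = 18`, `192d² = 1728` at `d = 3`; site sums shifted by ✓`Prop7FlatCoercivity.sum_shift`).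
At the member (`η = ℓ = (eta F n K)⁻¹`, `U_κ z = W♭⟨z,κ⟩`, `a = (3∕2)(Rℓ)⁻¹`, `a₂ = 6(Rℓ)⁻²`, `R = L^s`, `ε ≤ 2e·ℓ⁻²… from the plaquette clause of RegPr`): in the `c₀ℓ²` Hilbert currency
`‖divB_W u_i‖² + ‖curl_W u_i‖² ≤ C·(R⁻²‖D_Wφ_i‖² + R⁻⁴‖φ_i‖² + e²ℓ⁻²R⁻²‖φ_i‖²)` — NAMER WORD №10 (2)(b)'s row `h11` in (QH1)♮ letters is the member packaging (sibling file).
Letters: `divB ∕ covD ∕ covDstar (torusT (F.P K) 0)` of lit `B9Eq39Adjoint` (= px19 g6's DIV_HS letters of the engine ✓`sum_normSq_le_curl_sq_add_divB_sq_add_avg_T3`).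

References: T. Bałaban, CMP 99 (1985) 389–434 [Balaban1985BackgroundPropagators] ((3.100) pp.413–414: «the commutators … are first order differential operators with coefficients determined
by derivatives of the function h»; (3.8) p.392); CMP 96 (1984) 223–250 [Balaban1984PropagatorsII] (p.238).
-/

set_option autoImplicit false

noncomputable section

open scoped BigOperators Matrix.Norms.L2Operator Matrix

namespace Summit.QuantumFields.YangMills.Theorems.Prop7Lane2GradCommH1

open Literature.MathematicalPhysics.QuantumFieldTheory.Balaban1983to89
open Literature.MathematicalPhysics.QuantumFieldTheory.Balaban1983to89.T3ContinuumYM3Torus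
open B7Prop1Explicit (U1 mem_U1)
open B9Eq39Adjoint (R covD covDstar divB curl)
open B9TorusCalculus (torusT torusT_apply torusT_symm_apply torusT_comm)
open B9B8KnitLetterCoercive (hs_R_sub_R_le)
open Summit.QuantumFields.YangMills.Theorems.Prop7CovariantCoercivity (sum_norm_sq_R)
open Summit.QuantumFields.YangMills.Theorems.Prop7FlatCoercivity (sum_shift)
open B10StarCount (shift_unshift unshift_shift)
open Summit.QuantumFields.YangMills.Theorems.Prop7CovAgmonLetters (hs_smul hs_sum_le hs_add₃_le covD_smul_fun_src)
open Summit.QuantumFields.YangMills.Theorems.Prop7Lane2CutoffFamilyRows (sum_abs_sub_le_of_alive sum_abs_second_le_of_alive hs_weighted_le card_dir_eq_three)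
open Finset

/-! ## §1 ★ The exact formula -/

section Formula

variable {P : Params} {N : ℕ} (U : Fin P.d → Site P 0 → (Matrix (Fin N) (Fin N) ℂ)ˣ) (η : ℝ) (ζ : Site P 0 → ℝ) (l : Site P 0 → Matrix (Fin N) (Fin N) ℂ)

/-- `hs(A + B) ≤ 2(hs A + hs B)`. [folklore] -/
theorem hs_add_le (A B : Matrix (Fin N) (Fin N) ℂ) :
    ∑ j : Fin N, ∑ k : Fin N, ‖(A + B) j k‖ ^ 2 ≤ 2 * (∑ j : Fin N, ∑ k : Fin N, ‖A j k‖ ^ 2 + ∑ j : Fin N, ∑ k : Fin N, ‖B j k‖ ^ 2) := by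
  rw [mul_add, Finset.mul_sum, Finset.mul_sum, ← Finset.sum_add_distrib]
  refine Finset.sum_le_sum fun j _ => ?_
  rw [Finset.mul_sum, Finset.mul_sum, ← Finset.sum_add_distrib]
  refine Finset.sum_le_sum fun k _ => ?_
  rw [Matrix.add_apply]
  have h1 : ‖A j k + B j k‖ ≤ ‖A j k‖ + ‖B j k‖ := norm_add_le _ _
  have h0 : 0 ≤ ‖A j k + B j k‖ := norm_nonneg _
  nlinarith [h1, h0, sq_nonneg (‖A j k‖ - ‖B j k‖), norm_nonneg (A j k), norm_nonneg (B j k)]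

/-- ★ **THE COVARIANT DIVERGENCE OF THE GRADIENT COMMUTATOR, EXACTLY**: with `u(κ,z) = (η(ζ(z+e_κ) − ζ(z)))•Ad(U_κ z)λ(z+e_κ)`,
`divB u (x) = −Σ_μ[(η(ζ(x+e_μ) + ζ(x−e_μ) − 2ζ(x)))•λ(x) + (η(ζ(x+e_μ) − ζ(x)))•D_μλ(x)]` (`Ad(U⁻¹)Ad(U) = 1`; the scalar `η` stands for the member's `η⁻¹`).
[cite: Balaban1985BackgroundPropagators, (3.100) p.413, (3.8) p.392] -/
theorem divB_gradComm_apply (x : Site P 0) :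
    divB (torusT P 0) U (fun κ z => (η * (ζ (z.shift κ) - ζ z)) • R (U κ z) (l (z.shift κ))) x
      = -∑ μ : Fin P.d, ((η * (ζ (x.shift μ) + ζ (x.unshift μ) - 2 * ζ x)) • l x + (η * (ζ (x.shift μ) - ζ x)) • covD (torusT P 0) U μ l x) := by
  simp only [divB, covDstar, covD, torusT_apply, torusT_symm_apply, shift_unshift, B9Eq39Adjoint.R_smul, B9Eq39Adjoint.R_inv_R, ← Finset.sum_neg_distrib]
  refine Finset.sum_congr rfl fun μ _ => ?_
  rw [smul_sub]
  module

end Formula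

/-! ## §2 ★★ Per cutoff, localised -/

section PerCutoff

variable (F : T3Family) (K : ℕ) (U : Fin (F.P K).d → Site (F.P K) 0 → (Matrix (Fin 2) (Fin 2) ℂ)ˣ) (η : ℝ)
variable (ζ : Site (F.P K) 0 → ℝ) (l : Site (F.P K) 0 → Matrix (Fin 2) (Fin 2) ℂ)

/-- ★ **POINTWISE**: `hs(divB u (x)) ≤ 6η²·Σ_μ[(∂²_μζ(x))²·hs(λ x) + (∂_μζ(x))²·hs(D_μλ x)]`. [cite: Balaban1985BackgroundPropagators, (3.100) pp.413–414] -/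
theorem hs_divB_gradComm_point_le (x : Site (F.P K) 0) :
    ∑ j : Fin 2, ∑ k' : Fin 2, ‖(divB (torusT (F.P K) 0) U (fun κ z => (η * (ζ (z.shift κ) - ζ z)) • R (U κ z) (l (z.shift κ))) x) j k'‖ ^ 2
      ≤ 6 * η ^ 2 * ∑ μ : Fin (F.P K).d, ((ζ (x.shift μ) + ζ (x.unshift μ) - 2 * ζ x) ^ 2 * ∑ j : Fin 2, ∑ k' : Fin 2, ‖l x j k'‖ ^ 2
          + (ζ (x.shift μ) - ζ x) ^ 2 * ∑ j : Fin 2, ∑ k' : Fin 2, ‖(covD (torusT (F.P K) 0) U μ l x) j k'‖ ^ 2) := by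
  rw [divB_gradComm_apply, Prop7CovAgmonLetters.hs_neg]
  have h1 := hs_sum_le (N := 2) (Finset.univ : Finset (Fin (F.P K).d))
    (fun μ => (η * (ζ (x.shift μ) + ζ (x.unshift μ) - 2 * ζ x)) • l x + (η * (ζ (x.shift μ) - ζ x)) • covD (torusT (F.P K) 0) U μ l x)
  rw [Finset.card_univ, card_dir_eq_three] at h1
  refine h1.trans ?_
  have hμ : ∀ μ : Fin (F.P K).d, ∑ j : Fin 2, ∑ k' : Fin 2,
      ‖((η * (ζ (x.shift μ) + ζ (x.unshift μ) - 2 * ζ x)) • l x + (η * (ζ (x.shift μ) - ζ x)) • covD (torusT (F.P K) 0) U μ l x) j k'‖ ^ 2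
      ≤ 2 * η ^ 2 * ((ζ (x.shift μ) + ζ (x.unshift μ) - 2 * ζ x) ^ 2 * ∑ j : Fin 2, ∑ k' : Fin 2, ‖l x j k'‖ ^ 2
          + (ζ (x.shift μ) - ζ x) ^ 2 * ∑ j : Fin 2, ∑ k' : Fin 2, ‖(covD (torusT (F.P K) 0) U μ l x) j k'‖ ^ 2) := by
    intro μ
    refine (hs_add_le _ _).trans (le_of_eq ?_)
    rw [hs_smul, hs_smul]
    ring
  calc (3 : ℝ) * ∑ μ : Fin (F.P K).d, ∑ j : Fin 2, ∑ k' : Fin 2,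
          ‖((η * (ζ (x.shift μ) + ζ (x.unshift μ) - 2 * ζ x)) • l x + (η * (ζ (x.shift μ) - ζ x)) • covD (torusT (F.P K) 0) U μ l x) j k'‖ ^ 2
      ≤ 3 * ∑ μ : Fin (F.P K).d, 2 * η ^ 2 * ((ζ (x.shift μ) + ζ (x.unshift μ) - 2 * ζ x) ^ 2 * ∑ j : Fin 2, ∑ k' : Fin 2, ‖l x j k'‖ ^ 2
          + (ζ (x.shift μ) - ζ x) ^ 2 * ∑ j : Fin 2, ∑ k' : Fin 2, ‖(covD (torusT (F.P K) 0) U μ l x) j k'‖ ^ 2) :=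
        mul_le_mul_of_nonneg_left (Finset.sum_le_sum fun μ _ => hμ μ) (by norm_num)
    _ = _ := by rw [← Finset.mul_sum]; ring

/-- ★★ **PER CUTOFF, LOCALISED**: with steps `|ζ(x±e_μ) − ζ(x)| ≤ a`, second differences `≤ a₂`, and `S` containing every site where `ζ` is not locally constant,
`Σ_x hs(divB u (x)) ≤ 6η²·(3a₂²·Σ_{x∈S} hs(λ x) + a²·Σ_{x∈S}Σ_μ hs(D_μλ x))`. (Member: `η := (eta F n K)⁻¹ = ℓ`, `a = (3∕2)(Rℓ)⁻¹`, `a₂ = 6(Rℓ)⁻²` ⇒ with `c₀η⁻²`: `≤ 18·36·R⁻⁴‖λ̃‖² + 6·(9∕4)·R⁻²‖D_Wλ̃‖²`.)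
[cite: Balaban1985BackgroundPropagators, (3.100) pp.413–414] -/
theorem hs_divB_gradComm_sum_le {a a₂ : ℝ} (S : Finset (Site (F.P K) 0))
    (hζ1 : ∀ (x : Site (F.P K) 0) (μ : Fin (F.P K).d), |ζ (x.shift μ) - ζ x| ≤ a ∧ |ζ (x.unshift μ) - ζ x| ≤ a)
    (hζ2 : ∀ (x : Site (F.P K) 0) (μ : Fin (F.P K).d), |ζ (x.shift μ) + ζ (x.unshift μ) - 2 * ζ x| ≤ a₂)
    (hζS : ∀ x : Site (F.P K) 0, x ∉ S → ∀ μ : Fin (F.P K).d, ζ (x.shift μ) = ζ x ∧ ζ (x.unshift μ) = ζ x) :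
    ∑ x : Site (F.P K) 0, ∑ j : Fin 2, ∑ k' : Fin 2,
        ‖(divB (torusT (F.P K) 0) U (fun κ z => (η * (ζ (z.shift κ) - ζ z)) • R (U κ z) (l (z.shift κ))) x) j k'‖ ^ 2
      ≤ 6 * η ^ 2 * (3 * a₂ ^ 2 * ∑ x ∈ S, ∑ j : Fin 2, ∑ k' : Fin 2, ‖l x j k'‖ ^ 2
          + a ^ 2 * ∑ x ∈ S, ∑ μ : Fin (F.P K).d, ∑ j : Fin 2, ∑ k' : Fin 2, ‖(covD (torusT (F.P K) 0) U μ l x) j k'‖ ^ 2) := by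
  classical
  -- off `S` the divergence vanishes; on `S` use the pointwise bound with `|∂²ζ| ≤ a₂`, `|∂ζ| ≤ a`
  have hsite : ∀ x : Site (F.P K) 0, ∑ j : Fin 2, ∑ k' : Fin 2,
      ‖(divB (torusT (F.P K) 0) U (fun κ z => (η * (ζ (z.shift κ) - ζ z)) • R (U κ z) (l (z.shift κ))) x) j k'‖ ^ 2
      ≤ if x ∈ S then 6 * η ^ 2 * (3 * a₂ ^ 2 * ∑ j : Fin 2, ∑ k' : Fin 2, ‖l x j k'‖ ^ 2
          + a ^ 2 * ∑ μ : Fin (F.P K).d, ∑ j : Fin 2, ∑ k' : Fin 2, ‖(covD (torusT (F.P K) 0) U μ l x) j k'‖ ^ 2) else 0 := by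
    intro x
    by_cases hx : x ∈ S
    · rw [if_pos hx]
      refine (hs_divB_gradComm_point_le F K U η ζ l x).trans ?_
      have hl0 : 0 ≤ ∑ j : Fin 2, ∑ k' : Fin 2, ‖l x j k'‖ ^ 2 := Finset.sum_nonneg fun _ _ => Finset.sum_nonneg fun _ _ => sq_nonneg _
      have hterm : ∀ μ : Fin (F.P K).d, (ζ (x.shift μ) + ζ (x.unshift μ) - 2 * ζ x) ^ 2 * ∑ j : Fin 2, ∑ k' : Fin 2, ‖l x j k'‖ ^ 2
          + (ζ (x.shift μ) - ζ x) ^ 2 * ∑ j : Fin 2, ∑ k' : Fin 2, ‖(covD (torusT (F.P K) 0) U μ l x) j k'‖ ^ 2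
          ≤ a₂ ^ 2 * ∑ j : Fin 2, ∑ k' : Fin 2, ‖l x j k'‖ ^ 2 + a ^ 2 * ∑ j : Fin 2, ∑ k' : Fin 2, ‖(covD (torusT (F.P K) 0) U μ l x) j k'‖ ^ 2 := by
        intro μ
        have h1 : (ζ (x.shift μ) + ζ (x.unshift μ) - 2 * ζ x) ^ 2 ≤ a₂ ^ 2 := by
          rw [← sq_abs]; exact pow_le_pow_left₀ (abs_nonneg _) (hζ2 x μ) 2
        have h2 : (ζ (x.shift μ) - ζ x) ^ 2 ≤ a ^ 2 := by
          rw [← sq_abs]; exact pow_le_pow_left₀ (abs_nonneg _) (hζ1 x μ).1 2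
        exact add_le_add (mul_le_mul_of_nonneg_right h1 hl0)
          (mul_le_mul_of_nonneg_right h2 (Finset.sum_nonneg fun _ _ => Finset.sum_nonneg fun _ _ => sq_nonneg _))
      have hsum := Finset.sum_le_sum fun μ (_ : μ ∈ (Finset.univ : Finset (Fin (F.P K).d))) => hterm μ
      have hR : ∑ μ : Fin (F.P K).d, (a₂ ^ 2 * ∑ j : Fin 2, ∑ k' : Fin 2, ‖l x j k'‖ ^ 2
            + a ^ 2 * ∑ j : Fin 2, ∑ k' : Fin 2, ‖(covD (torusT (F.P K) 0) U μ l x) j k'‖ ^ 2)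
          = 3 * a₂ ^ 2 * ∑ j : Fin 2, ∑ k' : Fin 2, ‖l x j k'‖ ^ 2
            + a ^ 2 * ∑ μ : Fin (F.P K).d, ∑ j : Fin 2, ∑ k' : Fin 2, ‖(covD (torusT (F.P K) 0) U μ l x) j k'‖ ^ 2 := by
        rw [Finset.sum_add_distrib, Finset.sum_const, Finset.card_univ, ← Finset.mul_sum, nsmul_eq_mul, card_dir_eq_three]
        ring
      rw [← hR]
      exact mul_le_mul_of_nonneg_left hsum (by positivity)
    · rw [if_neg hx, divB_gradComm_apply]
      have h0 : ∀ μ : Fin (F.P K).d, (η * (ζ (x.shift μ) + ζ (x.unshift μ) - 2 * ζ x)) • l x + (η * (ζ (x.shift μ) - ζ x)) • covD (torusT (F.P K) 0) U μ l x = 0 := by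
        intro μ
        rw [(hζS x hx μ).1, (hζS x hx μ).2, show ζ x + ζ x - 2 * ζ x = 0 by ring, sub_self, mul_zero, zero_smul, zero_smul, add_zero]
      simp only [h0, Finset.sum_const_zero, neg_zero]
      simp
  have hsum := Finset.sum_le_sum fun x (_ : x ∈ (Finset.univ : Finset (Site (F.P K) 0))) => hsite x
  rw [Finset.sum_ite_mem, Finset.univ_inter] at hsum
  refine hsum.trans (le_of_eq ?_)
  rw [← Finset.mul_sum, Finset.sum_add_distrib, ← Finset.mul_sum, ← Finset.mul_sum]

end PerCutoff

/-! ## §3 ★ The exact curl identity -/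

section CurlFormula

variable {P : Params} {N : ℕ} (U : Fin P.d → Site P 0 → (Matrix (Fin N) (Fin N) ℂ)ˣ) (η : ℝ) (ζ : Site P 0 → ℝ) (l : Site P 0 → Matrix (Fin N) (Fin N) ℂ)

/-- ★ **THE COVARIANT CURL OF THE GRADIENT COMMUTATOR, EXACTLY.** [cite: Balaban1985BackgroundPropagators, (3.100) pp.413–414, (3.4) p.391] -/
theorem curl_gradComm_eq (x : Site P 0) (μ ν : Fin P.d) :
    curl (torusT P 0) U (fun κ z => (η * (ζ (z.shift κ) - ζ z)) • R (U κ z) (l (z.shift κ))) μ ν x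
      = (η * (ζ (x.shift ν) - ζ x)) • R (U ν x) (covD (torusT P 0) U μ l (x.shift ν))
        - (η * (ζ (x.shift μ) - ζ x)) • R (U μ x) (covD (torusT P 0) U ν l (x.shift μ))
        + (η * (ζ (x.shift ν) - ζ x) + η * (ζ (x.shift μ) - ζ x) + (η * (ζ ((x.shift μ).shift ν) - ζ (x.shift μ)) - η * (ζ (x.shift ν) - ζ x)))
          • (R (U μ x * U ν (x.shift μ)) (l ((x.shift μ).shift ν)) - R (U ν x * U μ (x.shift ν)) (l ((x.shift μ).shift ν))) := by
  have hc : (x.shift ν).shift μ = (x.shift μ).shift ν := by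
    have h := torusT_comm (P := P) (j := 0) μ ν x
    simpa only [torusT_apply] using h
  simp only [curl, covD, torusT_apply, B9Eq39Adjoint.R_smul, B9Eq39Adjoint.R_sub, B9Eq39Adjoint.R_mul, hc, smul_sub]
  module

end CurlFormula

/-! ## §4 ★★ The pointwise curl bound -/

section CurlPoint

variable {P : Params} {N : ℕ} [NeZero N] (U : Fin P.d → Site P 0 → (Matrix (Fin N) (Fin N) ℂ)ˣ) (η : ℝ) (ζ : Site P 0 → ℝ) (l : Site P 0 → Matrix (Fin N) (Fin N) ℂ)

/-- ★★ **POINTWISE**: `hs(curl u (x,μ,ν)) ≤ 3η²a²·[hs(D_μλ(x+e_ν)) + hs(D_νλ(x+e_μ))] + 192η²a²ε²·hs(λ(x+e_μ+e_ν))`. [cite: Balaban1985BackgroundPropagators, (3.100) pp.413–414] -/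
theorem hs_curl_gradComm_point_le (hUu : ∀ μ x, (U μ x : Matrix (Fin N) (Fin N) ℂ) ∈ unitary (Matrix (Fin N) (Fin N) ℂ))
    (hU1 : ∀ μ x, U μ x ∈ U1 (Matrix (Fin N) (Fin N) ℂ)) {a ε : ℝ} (ha : 0 ≤ a)
    (hstep : ∀ (x : Site P 0) (μ : Fin P.d), |ζ (x.shift μ) - ζ x| ≤ a)
    (hplaq : ∀ (x : Site P 0) (μ ν : Fin P.d), ‖((U μ x * U ν (x.shift μ) : (Matrix (Fin N) (Fin N) ℂ)ˣ) : Matrix (Fin N) (Fin N) ℂ) - (U ν x * U μ (x.shift ν) : (Matrix (Fin N) (Fin N) ℂ)ˣ)‖ ≤ ε)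
    (x : Site P 0) (μ ν : Fin P.d) :
    ∑ j : Fin N, ∑ k : Fin N, ‖(curl (torusT P 0) U (fun κ z => (η * (ζ (z.shift κ) - ζ z)) • R (U κ z) (l (z.shift κ))) μ ν x) j k‖ ^ 2
      ≤ 3 * η ^ 2 * a ^ 2 * (∑ j : Fin N, ∑ k : Fin N, ‖(covD (torusT P 0) U μ l (x.shift ν)) j k‖ ^ 2
            + ∑ j : Fin N, ∑ k : Fin N, ‖(covD (torusT P 0) U ν l (x.shift μ)) j k‖ ^ 2)
        + 192 * η ^ 2 * a ^ 2 * ε ^ 2 * ∑ j : Fin N, ∑ k : Fin N, ‖l ((x.shift μ).shift ν) j k‖ ^ 2 := by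
  rw [curl_gradComm_eq]
  -- three terms
  set A := (η * (ζ (x.shift ν) - ζ x)) • R (U ν x) (covD (torusT P 0) U μ l (x.shift ν)) with hA
  set B := (η * (ζ (x.shift μ) - ζ x)) • R (U μ x) (covD (torusT P 0) U ν l (x.shift μ)) with hB
  set c := η * (ζ (x.shift ν) - ζ x) + η * (ζ (x.shift μ) - ζ x) + (η * (ζ ((x.shift μ).shift ν) - ζ (x.shift μ)) - η * (ζ (x.shift ν) - ζ x)) with hc
  set C := c • (R (U μ x * U ν (x.shift μ)) (l ((x.shift μ).shift ν)) - R (U ν x * U μ (x.shift ν)) (l ((x.shift μ).shift ν))) with hC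
  have h3 : ∑ j : Fin N, ∑ k : Fin N, ‖(A - B + C) j k‖ ^ 2
      ≤ 3 * (∑ j : Fin N, ∑ k : Fin N, ‖A j k‖ ^ 2 + ∑ j : Fin N, ∑ k : Fin N, ‖B j k‖ ^ 2 + ∑ j : Fin N, ∑ k : Fin N, ‖C j k‖ ^ 2) := by
    have h := hs_add₃_le A (-B) C
    rw [Prop7CovAgmonLetters.hs_neg] at h
    have e : A - B + C = A + -B + C := by abel
    rw [e]; exact h
  refine h3.trans ?_
  -- the three pieces
  have hAe : ∑ j : Fin N, ∑ k : Fin N, ‖A j k‖ ^ 2 = (η * (ζ (x.shift ν) - ζ x)) ^ 2 * ∑ j : Fin N, ∑ k : Fin N, ‖(covD (torusT P 0) U μ l (x.shift ν)) j k‖ ^ 2 := by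
    rw [hA, hs_smul, sum_norm_sq_R (hUu ν x)]
  have hBe : ∑ j : Fin N, ∑ k : Fin N, ‖B j k‖ ^ 2 = (η * (ζ (x.shift μ) - ζ x)) ^ 2 * ∑ j : Fin N, ∑ k : Fin N, ‖(covD (torusT P 0) U ν l (x.shift μ)) j k‖ ^ 2 := by
    rw [hB, hs_smul, sum_norm_sq_R (hUu μ x)]
  have hCe : ∑ j : Fin N, ∑ k : Fin N, ‖C j k‖ ^ 2 ≤ c ^ 2 * (4 * ε ^ 2 * ∑ j : Fin N, ∑ k : Fin N, ‖l ((x.shift μ).shift ν) j k‖ ^ 2) := by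
    rw [hC, hs_smul]
    refine mul_le_mul_of_nonneg_left ?_ (sq_nonneg _)
    exact hs_R_sub_R_le (mem_U1.mp ((U1 _).mul_mem (hU1 μ x) (hU1 ν (x.shift μ)))) (mem_U1.mp ((U1 _).mul_mem (hU1 ν x) (hU1 μ (x.shift ν))))
      (hplaq x μ ν) _
  -- scalar sizes
  have hwν : (η * (ζ (x.shift ν) - ζ x)) ^ 2 ≤ η ^ 2 * a ^ 2 := by
    rw [mul_pow, ← sq_abs (ζ _ - ζ _)]
    exact mul_le_mul_of_nonneg_left (pow_le_pow_left₀ (abs_nonneg _) (hstep x ν) 2) (sq_nonneg _)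
  have hwμ : (η * (ζ (x.shift μ) - ζ x)) ^ 2 ≤ η ^ 2 * a ^ 2 := by
    rw [mul_pow, ← sq_abs (ζ _ - ζ _)]
    exact mul_le_mul_of_nonneg_left (pow_le_pow_left₀ (abs_nonneg _) (hstep x μ) 2) (sq_nonneg _)
  have hcabs : |c| ≤ 4 * (|η| * a) := by
    have h1 : |η * (ζ (x.shift ν) - ζ x)| ≤ |η| * a := by rw [abs_mul]; exact mul_le_mul_of_nonneg_left (hstep x ν) (abs_nonneg _)
    have h2 : |η * (ζ (x.shift μ) - ζ x)| ≤ |η| * a := by rw [abs_mul]; exact mul_le_mul_of_nonneg_left (hstep x μ) (abs_nonneg _)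
    have h3' : |η * (ζ ((x.shift μ).shift ν) - ζ (x.shift μ))| ≤ |η| * a := by
      rw [abs_mul]; exact mul_le_mul_of_nonneg_left (hstep (x.shift μ) ν) (abs_nonneg _)
    rw [hc]
    calc _ ≤ |η * (ζ (x.shift ν) - ζ x)| + |η * (ζ (x.shift μ) - ζ x)| + (|η * (ζ ((x.shift μ).shift ν) - ζ (x.shift μ))| + |η * (ζ (x.shift ν) - ζ x)|) :=
          (abs_add_le _ _).trans (add_le_add (abs_add_le _ _) (abs_sub _ _))
      _ ≤ _ := by linarith
  have hc2 : c ^ 2 ≤ 16 * (η ^ 2 * a ^ 2) := by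
    have h0 : 0 ≤ 4 * (|η| * a) := by positivity
    calc c ^ 2 = |c| ^ 2 := (sq_abs c).symm
      _ ≤ (4 * (|η| * a)) ^ 2 := pow_le_pow_left₀ (abs_nonneg _) hcabs 2
      _ = 16 * (η ^ 2 * a ^ 2) := by rw [mul_pow, mul_pow, sq_abs]; ring
  have hG1 : 0 ≤ ∑ j : Fin N, ∑ k : Fin N, ‖(covD (torusT P 0) U μ l (x.shift ν)) j k‖ ^ 2 := Finset.sum_nonneg fun _ _ => Finset.sum_nonneg fun _ _ => sq_nonneg _
  have hG2 : 0 ≤ ∑ j : Fin N, ∑ k : Fin N, ‖(covD (torusT P 0) U ν l (x.shift μ)) j k‖ ^ 2 := Finset.sum_nonneg fun _ _ => Finset.sum_nonneg fun _ _ => sq_nonneg _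
  have hL : 0 ≤ 4 * ε ^ 2 * ∑ j : Fin N, ∑ k : Fin N, ‖l ((x.shift μ).shift ν) j k‖ ^ 2 := by
    have : 0 ≤ ∑ j : Fin N, ∑ k : Fin N, ‖l ((x.shift μ).shift ν) j k‖ ^ 2 := Finset.sum_nonneg fun _ _ => Finset.sum_nonneg fun _ _ => sq_nonneg _
    positivity
  rw [hAe, hBe]
  nlinarith [mul_le_mul_of_nonneg_right hwν hG1, mul_le_mul_of_nonneg_right hwμ hG2, hCe, mul_le_mul_of_nonneg_right hc2 hL]

/-! ## §5 ★★ The curl bound summed over sites and direction pairs -/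

/-- Bookkeeping: `Σ_xΣ_μΣ_ν (c₁(A_μ(x+ν) + A_ν(x+μ)) + c₂ L(x+μ+ν)) = 2d·c₁·Σ_xΣ_μ A_μ(x) + d²·c₂·Σ_x L(x)`
(site sums are shift-invariant on the torus). -/
theorem sum_curl_bookkeeping (A : Fin P.d → Site P 0 → ℝ) (Lx : Site P 0 → ℝ) (c₁ c₂ : ℝ) :
    ∑ x : Site P 0, ∑ μ : Fin P.d, ∑ ν : Fin P.d, (c₁ * (A μ (x.shift ν) + A ν (x.shift μ)) + c₂ * Lx ((x.shift μ).shift ν))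
      = 2 * P.d * c₁ * ∑ x : Site P 0, ∑ μ : Fin P.d, A μ x + (P.d : ℝ) ^ 2 * c₂ * ∑ x : Site P 0, Lx x := by
  have hs1 : ∀ μ ν : Fin P.d, ∑ x : Site P 0, A μ (x.shift ν) = ∑ x : Site P 0, A μ x := fun μ ν =>
    sum_shift (P := P) (i := 0) ν (A μ)
  have hs2 : ∀ μ ν : Fin P.d, ∑ x : Site P 0, Lx ((x.shift μ).shift ν) = ∑ x : Site P 0, Lx x := fun μ ν =>
    (sum_shift (P := P) (i := 0) μ (fun x => Lx (x.shift ν))).trans (sum_shift (P := P) (i := 0) ν Lx)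
  have hc : ∑ x : Site P 0, ∑ μ : Fin P.d, ∑ ν : Fin P.d, (c₁ * (A μ (x.shift ν) + A ν (x.shift μ)) + c₂ * Lx ((x.shift μ).shift ν))
      = ∑ μ : Fin P.d, ∑ ν : Fin P.d, ∑ x : Site P 0, (c₁ * (A μ (x.shift ν) + A ν (x.shift μ)) + c₂ * Lx ((x.shift μ).shift ν)) :=
    Finset.sum_comm.trans (Finset.sum_congr rfl fun μ _ => Finset.sum_comm)
  rw [hc]
  have e1 : ∀ μ ν : Fin P.d, ∑ x : Site P 0, (c₁ * (A μ (x.shift ν) + A ν (x.shift μ)) + c₂ * Lx ((x.shift μ).shift ν))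
      = c₁ * ∑ x : Site P 0, A μ x + c₁ * ∑ x : Site P 0, A ν x + c₂ * ∑ x : Site P 0, Lx x := by
    intro μ ν
    rw [← hs1 μ ν, ← hs1 ν μ, ← hs2 μ ν, Finset.mul_sum, Finset.mul_sum, Finset.mul_sum, ← Finset.sum_add_distrib,
      ← Finset.sum_add_distrib]
    exact Finset.sum_congr rfl fun x _ => by ring
  simp only [e1]
  rw [show (∑ x : Site P 0, ∑ μ : Fin P.d, A μ x) = ∑ μ : Fin P.d, ∑ x : Site P 0, A μ x from Finset.sum_comm]
  simp only [Finset.sum_add_distrib, Finset.sum_const, Finset.card_univ, Fintype.card_fin, nsmul_eq_mul, ← Finset.mul_sum]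
  ring

/-- ★★ **SUMMED**: `Σ_xΣ_μΣ_ν hs(curl u (x,μ,ν)) ≤ 6d·η²a²·Σ_xΣ_μ hs(D_μλ x) + 192d²·η²a²ε²·Σ_x hs(λ x)` (`d = P.d`; at the member `d = 3`: `18` and `1728`).
[cite: Balaban1985BackgroundPropagators, (3.100) pp.413–414] -/
theorem hs_curl_gradComm_sum_le (hUu : ∀ μ x, (U μ x : Matrix (Fin N) (Fin N) ℂ) ∈ unitary (Matrix (Fin N) (Fin N) ℂ))
    (hU1 : ∀ μ x, U μ x ∈ U1 (Matrix (Fin N) (Fin N) ℂ)) {a ε : ℝ} (ha : 0 ≤ a)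
    (hstep : ∀ (x : Site P 0) (μ : Fin P.d), |ζ (x.shift μ) - ζ x| ≤ a)
    (hplaq : ∀ (x : Site P 0) (μ ν : Fin P.d), ‖((U μ x * U ν (x.shift μ) : (Matrix (Fin N) (Fin N) ℂ)ˣ) : Matrix (Fin N) (Fin N) ℂ) - (U ν x * U μ (x.shift ν) : (Matrix (Fin N) (Fin N) ℂ)ˣ)‖ ≤ ε) :
    ∑ x : Site P 0, ∑ μ : Fin P.d, ∑ ν : Fin P.d, ∑ j : Fin N, ∑ k : Fin N,
        ‖(curl (torusT P 0) U (fun κ z => (η * (ζ (z.shift κ) - ζ z)) • R (U κ z) (l (z.shift κ))) μ ν x) j k‖ ^ 2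
      ≤ 6 * P.d * (η ^ 2 * a ^ 2) * ∑ x : Site P 0, ∑ μ : Fin P.d, ∑ j : Fin N, ∑ k : Fin N, ‖(covD (torusT P 0) U μ l x) j k‖ ^ 2
        + 192 * (P.d : ℝ) ^ 2 * (η ^ 2 * a ^ 2 * ε ^ 2) * ∑ x : Site P 0, ∑ j : Fin N, ∑ k : Fin N, ‖l x j k‖ ^ 2 := by
  -- sum the pointwise bound
  have hpt := fun x μ ν => hs_curl_gradComm_point_le U η ζ l hUu hU1 ha hstep hplaq x μ ν
  have h1 : ∑ x : Site P 0, ∑ μ : Fin P.d, ∑ ν : Fin P.d, ∑ j : Fin N, ∑ k : Fin N,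
        ‖(curl (torusT P 0) U (fun κ z => (η * (ζ (z.shift κ) - ζ z)) • R (U κ z) (l (z.shift κ))) μ ν x) j k‖ ^ 2
      ≤ ∑ x : Site P 0, ∑ μ : Fin P.d, ∑ ν : Fin P.d, (3 * η ^ 2 * a ^ 2 * (∑ j : Fin N, ∑ k : Fin N, ‖(covD (torusT P 0) U μ l (x.shift ν)) j k‖ ^ 2
            + ∑ j : Fin N, ∑ k : Fin N, ‖(covD (torusT P 0) U ν l (x.shift μ)) j k‖ ^ 2)
        + 192 * η ^ 2 * a ^ 2 * ε ^ 2 * ∑ j : Fin N, ∑ k : Fin N, ‖l ((x.shift μ).shift ν) j k‖ ^ 2) :=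
    Finset.sum_le_sum fun x _ => Finset.sum_le_sum fun μ _ => Finset.sum_le_sum fun ν _ => hpt x μ ν
  have h2 := sum_curl_bookkeeping (P := P) (fun μ y => ∑ j : Fin N, ∑ k : Fin N, ‖(covD (torusT P 0) U μ l y) j k‖ ^ 2)
    (fun y => ∑ j : Fin N, ∑ k : Fin N, ‖l y j k‖ ^ 2) (3 * η ^ 2 * a ^ 2) (192 * η ^ 2 * a ^ 2 * ε ^ 2)
  beta_reduce at h2
  exact h1.trans (le_of_eq (h2.trans (by ring)))

end CurlPoint

end Summit.QuantumFields.YangMills.Theorems.Prop7Lane2GradCommH1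

end
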